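import Mathlib
import HarnessLib
import Summits.NavierStokesRegularity.NavierStokesRegularity.Theorems.PoloidalWindowDoorLrcModEntirePoleArgument
import Summits.NavierStokesRegularity.NavierStokesRegularity.Theorems.PoloidalWindowDoorLrcModEntirePoleArgumentFlat

/-!
# Route `PoloidalWindowDoor`, item `LrcModEntire` (stmt-NavierStokesRegularity-20428), (Q4) column —
# B-POLE, UNIFORM FORM (joint-sufficiency item J4 + J1): no Cramer hypothesis, and «(P) on `ℝ × I` ⇒ `k′ ≡ 0`»

Cell ns-regularity-ideate, helper seat ns-k2-port-2 g9 (assembly owner per idea-crit-7 g12 23:21:50Z) under the LEAD of item 20428 (ns-poloidal-K2-p3 g17).  GLUE over the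
LEAD's B-POLE files `…PoleArgument.pole_argument` (non-degenerate triple, hypothesis `hD`) and `…PoleArgumentFlat.pole_argument_flat` (`c′ ≡ 0`); memo
`Cruxes/LrcModEntire/TOWER-CLOSES-port2g9.md` §C2/§C3, `T2B-g17.md` §14, idea-crit-7 g12 J1/J4 (23:29:26Z, 23:41:00Z).  `--supports stmt-NavierStokesRegularity-20428 --as helper`.
CLASS-FREE.

* `nondegenerate_triple` — if `c′(m₁) ≠ 0` for one `m₁ ∈ W ∖ {0}` (and `W ∖ {0}` is infinite, `c ≠ 0` on `W`), there are `m₀, m₂ ∈ W` with the LEAD's Cramer determinant of the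
  triple `(m₀, m₁, m₂)` non-zero at `κ₀ = 1/m₀`: `D(1/m₀) = 4c(m₀)·(1−m₁/m₀)²(1−m₂/m₀)²·(c′(m₁)(1 − m₂/m₀) − c′(m₂)(1 − m₁/m₀))`, and the last factor is a non-zero linear polynomial
  in `1/m₀`, so it vanishes for at most finitely many `m₀` (J4).
* ★ `pole_argument_uniform` — (P) on `K₀ × W` (`K₀`, `W ∖ {0}` infinite, `c ≠ 0`) ⊢ `∃ κ ∈ K₀, υ κ = 0`, by cases on `∃ m₁ ∈ W ∖ {0}, c′ m₁ ≠ 0` (LEAD's two theorems).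
* ★ `pole_argument_uniform_along` — the same along the branch (`k` injective on an infinite `S₀`, `υ = k′²`): `∃ s ∈ S₀, k′ s = 0` (LEAD's `invFunOn` section trick).
* ★★ `curvature_deriv_eq_zero_of_first_integral` — HEIGHT currency for the assembly, LOCAL in `s` (B-TWPc is local in the arclength): if (P) holds at the heights
  `m = d(z)` for all `s` in an open `S ∋ s₀` and all `z ∈ I` (`(d '' I) ∖ {0}` infinite, `c ≠ 0` on `I`), `k` has a continuous derivative `k′` on `S`, then **`k′(s₀) = 0`**
  (J1: else `k′ ≠ 0` on an interval around `s₀`, `k` injective there by Rolle, and `pole_argument_uniform_along` produces a zero of `k′` inside — contradiction).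

WHAT THIS IS NOT: not a claim about Navier–Stokes regularity and not a stub of the registry; class-free algebra/analysis for the residual research cells
`stub_Q4curvedAperiodic` / `stub_Q4sonicLineNegIsolated` of `Cruxes/LrcModEntire/Lines/twist_split.lean` (v14; items 20428 / 19708 / 27893 OPEN).
-/

noncomputable section

set_option linter.dupNamespace false
set_option linter.style.longLine false

namespace Summit.NavierStokesRegularity.NavierStokesRegularity.Theorems.PoloidalWindowDoorLrcModEntirePoleArgumentUniform

open Set Function Polynomial
open Summit.NavierStokesRegularity.NavierStokesRegularity.Theorems.PoloidalWindowDoorLrcModEntirePoleArgument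
open Summit.NavierStokesRegularity.NavierStokesRegularity.Theorems.PoloidalWindowDoorLrcModEntirePoleArgumentFlat

/-! ### J4 — a non-degenerate triple from one height with `c′ ≠ 0` -/

/-- **J4.**  See the module docstring. -/
theorem nondegenerate_triple {W : Set ℝ} (hW : (W \ {0}).Infinite) {c c' : ℝ → ℝ} (hc : ∀ m ∈ W, c m ≠ 0)
    {m₁ : ℝ} (hm₁ : m₁ ∈ W \ {0}) (hc1 : c' m₁ ≠ 0) :
    ∃ m₀ ∈ W, ∃ m₂ ∈ W, ∃ κ₀ : ℝ,
      (c' m₀ * (1 - κ₀ * m₀) ^ 2) * ((3 * m₁ * c' m₁ * (1 - κ₀ * m₁) + 4 * c m₁) * (-(1 - κ₀ * m₂) ^ 3)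
          - (-(1 - κ₀ * m₁) ^ 3) * (3 * m₂ * c' m₂ * (1 - κ₀ * m₂) + 4 * c m₂))
        - (3 * m₀ * c' m₀ * (1 - κ₀ * m₀) + 4 * c m₀) * ((c' m₁ * (1 - κ₀ * m₁) ^ 2) * (-(1 - κ₀ * m₂) ^ 3)
          - (-(1 - κ₀ * m₁) ^ 3) * (c' m₂ * (1 - κ₀ * m₂) ^ 2))
        + (-(1 - κ₀ * m₀) ^ 3) * ((c' m₁ * (1 - κ₀ * m₁) ^ 2) * (3 * m₂ * c' m₂ * (1 - κ₀ * m₂) + 4 * c m₂)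
          - (3 * m₁ * c' m₁ * (1 - κ₀ * m₁) + 4 * c m₁) * (c' m₂ * (1 - κ₀ * m₂) ^ 2)) ≠ 0 := by
  classical
  obtain ⟨hm₁W, hm₁0⟩ := hm₁
  have hm₁0' : m₁ ≠ 0 := hm₁0
  -- a second height
  obtain ⟨m₂, hm₂⟩ := (hW.sdiff (Set.finite_singleton m₁)).nonempty
  have hm₂W : m₂ ∈ W := hm₂.1.1
  have hm₂1 : m₂ ≠ m₁ := fun h => hm₂.2 (by simp [h])
  -- the polynomial `P(x) = (1 − m₁x)²(1 − m₂x)²·(c′(m₁)(1 − m₂x) − c′(m₂)(1 − m₁x))` in `x = 1/m₀`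
  set L : ℝ[X] := C (c' m₁) * (1 - C m₂ * X) - C (c' m₂) * (1 - C m₁ * X) with hL
  have hL0 : L ≠ 0 := by
    intro h0
    have := congrArg (fun p : ℝ[X] => p.eval m₁⁻¹) h0
    simp only [hL, eval_sub, eval_mul, eval_C, eval_one, eval_X, eval_zero] at this
    have hh : 1 - m₁ * m₁⁻¹ = (0 : ℝ) := by rw [mul_inv_cancel₀ hm₁0']; ring
    have h' : c' m₁ * (1 - m₂ * m₁⁻¹) = 0 := by linear_combination this + c' m₂ * hh
    rcases mul_eq_zero.1 h' with h1 | h1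
    · exact hc1 h1
    · apply hm₂1
      field_simp at h1
      linarith
  have hj0 : ∀ m : ℝ, (1 - C m * X : ℝ[X]) ≠ 0 := by
    intro m h
    have := congrArg (fun p : ℝ[X] => p.eval 0) h
    simp at this
  set P : ℝ[X] := (1 - C m₁ * X) ^ 2 * (1 - C m₂ * X) ^ 2 * L with hP
  have hP0 : P ≠ 0 := mul_ne_zero (mul_ne_zero (pow_ne_zero 2 (hj0 m₁)) (pow_ne_zero 2 (hj0 m₂))) hL0
  -- some inverse height is not a root
  have hinv : ((fun m : ℝ => m⁻¹) '' (W \ {0})).Infinite := hW.image inv_injective.injOn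
  obtain ⟨_, ⟨m₀, hm₀, rfl⟩, hPm₀⟩ : ∃ x ∈ (fun m : ℝ => m⁻¹) '' (W \ {0}), P.eval x ≠ 0 := by
    by_contra h
    simp only [not_exists, not_and, not_not] at h
    exact hP0 (poly_eq_zero_of_eval_eq_zero_on hinv h)
  have hm₀0 : m₀ ≠ 0 := hm₀.2
  refine ⟨m₀, hm₀.1, m₂, hm₂W, m₀⁻¹, ?_⟩
  have h0 : 1 - m₀⁻¹ * m₀ = 0 := by rw [inv_mul_cancel₀ hm₀0]; ring
  rw [h0]
  simp only [hP, hL, eval_mul, eval_pow, eval_sub, eval_C, eval_one, eval_X] at hPm₀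
  intro hD
  apply hPm₀
  have hc0 : c m₀ ≠ 0 := hc m₀ hm₀.1
  have : 4 * c m₀ * ((1 - m₁ * m₀⁻¹) ^ 2 * (1 - m₂ * m₀⁻¹) ^ 2 * (c' m₁ * (1 - m₂ * m₀⁻¹) - c' m₂ * (1 - m₁ * m₀⁻¹))) = 0 := by
    linear_combination hD
  rcases mul_eq_zero.1 this with h | h
  · exact absurd (by linear_combination h / 4) hc0
  · linear_combination h

/-! ### The uniform pole argument -/

/-- ★ **B-POLE, uniform form** (no Cramer hypothesis). -/
theorem pole_argument_uniform {K₀ W : Set ℝ} (hK₀ : K₀.Infinite) (hW : (W \ {0}).Infinite)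
    (ξ υ Z c c' e₀ e₁ e₂ e₃ : ℝ → ℝ) (hc : ∀ m ∈ W, c m ≠ 0)
    (hP : ∀ κ ∈ K₀, ∀ m ∈ W,
      ξ κ * (c' m * (1 - κ * m) ^ 2) + υ κ * (3 * m * c' m * (1 - κ * m) + 4 * c m) - Z κ * (1 - κ * m) ^ 3
        + (1 - κ * m) ^ 3 * (e₀ m + e₁ m * κ + e₂ m * κ ^ 2 + e₃ m * κ ^ 3) = 0) :
    ∃ κ ∈ K₀, υ κ = 0 := by
  by_cases h1 : ∃ m₁ ∈ W \ {0}, c' m₁ ≠ 0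
  · obtain ⟨m₁, hm₁, hc1⟩ := h1
    obtain ⟨m₀, hm₀, m₂, hm₂, hD⟩ := nondegenerate_triple hW hc hm₁ hc1
    exact pole_argument hK₀ hW ξ υ Z c c' e₀ e₁ e₂ e₃ hc hP hm₀ hm₁.1 hm₂ hD
  · -- `c′ ≡ 0` on `W ∖ {0}`: the flat system
    simp only [not_exists, not_and, not_not] at h1
    set W' : Set ℝ := W \ {0} with hW'
    have hW'' : (W' \ {0}).Infinite := by
      have : W' \ {0} = W' := by
        ext m; simp only [hW', mem_sdiff, mem_singleton_iff]; tauto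
      rw [this]; exact hW
    have hc' : ∀ m ∈ W', c m ≠ 0 := fun m hm => hc m hm.1
    have hP' : ∀ κ ∈ K₀, ∀ m ∈ W', υ κ * (4 * c m) - Z κ * (1 - κ * m) ^ 3
        + (1 - κ * m) ^ 3 * (e₀ m + e₁ m * κ + e₂ m * κ ^ 2 + e₃ m * κ ^ 3) = 0 := by
      intro κ hκ m hm
      have h := hP κ hκ m hm.1
      rw [h1 m hm] at h
      linear_combination h
    obtain ⟨m₁, hm₁⟩ := hW.nonempty
    obtain ⟨m₂, hm₂⟩ := (hW.sdiff (Set.finite_singleton m₁)).nonempty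
    have hm₂' : m₂ ∈ W' \ {0} := ⟨hm₂.1, hm₂.1.2⟩
    have hm₁' : m₁ ∈ W' \ {0} := ⟨hm₁, hm₁.2⟩
    have hne : m₁ ≠ m₂ := fun h => hm₂.2 (by simp [h])
    exact pole_argument_flat hK₀ hW'' υ Z c e₀ e₁ e₂ e₃ hc' hP' hm₁' hm₂' hne

/-- ★ **B-POLE, uniform form along the branch:** `k` injective on an infinite `S₀`, `υ = k′²`. -/
theorem pole_argument_uniform_along {S₀ W : Set ℝ} (hS₀ : S₀.Infinite) (hW : (W \ {0}).Infinite)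
    (k k₁ k₂ Zs c c' e₀ e₁ e₂ e₃ : ℝ → ℝ) (hinj : InjOn k S₀) (hc : ∀ m ∈ W, c m ≠ 0)
    (hP : ∀ s ∈ S₀, ∀ m ∈ W,
      k₂ s * (c' m * (1 - k s * m) ^ 2) + k₁ s ^ 2 * (3 * m * c' m * (1 - k s * m) + 4 * c m) - Zs s * (1 - k s * m) ^ 3
        + (1 - k s * m) ^ 3 * (e₀ m + e₁ m * k s + e₂ m * k s ^ 2 + e₃ m * k s ^ 3) = 0) :
    ∃ s ∈ S₀, k₁ s = 0 := by
  set K₀ : Set ℝ := k '' S₀ with hK₀_def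
  have hK₀ : K₀.Infinite := hS₀.image hinj
  let σ : ℝ → ℝ := invFunOn k S₀
  have hσ : ∀ κ ∈ K₀, σ κ ∈ S₀ ∧ k (σ κ) = κ := fun κ hκ => by
    obtain ⟨s, hs, rfl⟩ := hκ
    exact ⟨invFunOn_mem ⟨s, hs, rfl⟩, invFunOn_eq ⟨s, hs, rfl⟩⟩
  obtain ⟨κ, hκ, hυ⟩ := pole_argument_uniform hK₀ hW (fun κ => k₂ (σ κ)) (fun κ => k₁ (σ κ) ^ 2) (fun κ => Zs (σ κ)) c c' e₀ e₁ e₂ e₃ hc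
    (fun κ hκ m hm => by
      obtain ⟨hsS, hks⟩ := hσ κ hκ
      have h := hP (σ κ) hsS m hm
      rw [hks] at h
      exact h)
  obtain ⟨hsS, -⟩ := hσ κ hκ
  exact ⟨σ κ, hsS, pow_eq_zero_iff two_ne_zero |>.1 hυ⟩

/-! ### J1 — the first integral at the heights `m = d(z)` near `s₀` forces `k′(s₀) = 0` -/

/-- ★★ **`k′(s₀) = 0` from the first integral in height currency, LOCALLY in `s`.**  If (P) holds at the heights `m = d(z)` for all `s` in an open set `S ∋ s₀` and all
`z ∈ I` (`(d '' I) ∖ {0}` infinite, `c ≠ 0` on `I`), `k` has the continuous derivative `k′` on `S` (`HasDerivAt k (k′ s) s`, `k′` continuous at the points of `S`), then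
`k′(s₀) = 0`.  (J1: otherwise `k′ ≠ 0` on an interval around `s₀`, `k` is injective there by Rolle, and `pole_argument_uniform_along` produces a zero of `k′` inside.)
Apply at every `s₀` (B-TWPc is local in the arclength) to get `k′ ≡ 0`. -/
theorem curvature_deriv_eq_zero_of_first_integral {S I : Set ℝ} {k k₁ k₂ Zs d c c₁ e₀ e₁ e₂ e₃ : ℝ → ℝ} {s₀ : ℝ}
    (hS : IsOpen S) (hs₀ : s₀ ∈ S)
    (hk : ∀ s ∈ S, HasDerivAt k (k₁ s) s) (hk₁ : ∀ s ∈ S, ContinuousAt k₁ s)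
    (hW : ((d '' I) \ {0}).Infinite) (hc : ∀ z ∈ I, c z ≠ 0)
    (hP : ∀ s ∈ S, ∀ z ∈ I,
      k₂ s * (c₁ z * (1 - k s * d z) ^ 2) + k₁ s ^ 2 * (3 * d z * c₁ z * (1 - k s * d z) + 4 * c z) - Zs s * (1 - k s * d z) ^ 3
        + (1 - k s * d z) ^ 3 * (e₀ z + e₁ z * k s + e₂ z * k s ^ 2 + e₃ z * k s ^ 3) = 0) :
    k₁ s₀ = 0 := by
  -- heights and a section of `d`
  set W : Set ℝ := d '' I with hWdef
  let σ : ℝ → ℝ := invFunOn d I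
  have hσ : ∀ m ∈ W, σ m ∈ I ∧ d (σ m) = m := fun m hm => by
    obtain ⟨z, hz, rfl⟩ := hm
    exact ⟨invFunOn_mem ⟨z, hz, rfl⟩, invFunOn_eq ⟨z, hz, rfl⟩⟩
  have hcW : ∀ m ∈ W, c (σ m) ≠ 0 := fun m hm => hc _ (hσ m hm).1
  -- (P) transported to the heights
  have hPW : ∀ s ∈ S, ∀ m ∈ W,
      k₂ s * ((c₁ (σ m)) * (1 - k s * m) ^ 2) + k₁ s ^ 2 * (3 * m * c₁ (σ m) * (1 - k s * m) + 4 * c (σ m)) - Zs s * (1 - k s * m) ^ 3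
        + (1 - k s * m) ^ 3 * (e₀ (σ m) + e₁ (σ m) * k s + e₂ (σ m) * k s ^ 2 + e₃ (σ m) * k s ^ 3) = 0 := by
    intro s hs m hm
    obtain ⟨hzI, hdz⟩ := hσ m hm
    have h := hP s hs (σ m) hzI
    rw [hdz] at h
    exact h
  by_contra hne0
  -- `k′ ≠ 0` on an open interval around `s₀` inside `S`
  obtain ⟨ε, hε, hball⟩ : ∃ ε > 0, ∀ s, dist s s₀ < ε → s ∈ S ∧ k₁ s ≠ 0 := by
    have h1 : ∀ᶠ s in nhds s₀, s ∈ S := hS.mem_nhds hs₀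
    have h2 : ∀ᶠ s in nhds s₀, k₁ s ≠ 0 := (hk₁ s₀ hs₀).eventually_ne hne0
    obtain ⟨ε, hε, hsub⟩ := Metric.eventually_nhds_iff.1 (h1.and h2)
    exact ⟨ε, hε, fun s hs => hsub hs⟩
  set S₀ : Set ℝ := Ioo (s₀ - ε) (s₀ + ε) with hS₀def
  have hS₀ : ∀ s ∈ S₀, s ∈ S ∧ k₁ s ≠ 0 := fun s hs => hball s (by
    rw [Real.dist_eq, abs_lt]; constructor <;> linarith [hs.1, hs.2])
  have hS₀inf : S₀.Infinite := Ioo_infinite (by linarith)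
  -- `k` is injective on `S₀` (Rolle)
  have hinj : InjOn k S₀ := by
    intro a ha b hb hab
    by_contra hne
    have hIcc : ∀ {x y : ℝ}, x ∈ S₀ → y ∈ S₀ → ∀ u ∈ Icc x y, u ∈ S₀ := fun hx hy u hu =>
      ⟨by linarith [hx.1, hu.1], by linarith [hy.2, hu.2]⟩
    rcases lt_or_gt_of_ne hne with hlt | hlt
    · obtain ⟨x, hx, hx0⟩ := exists_hasDerivAt_eq_zero hlt
        (fun u hu => (hk u (hS₀ u (hIcc ha hb u hu)).1).continuousAt.continuousWithinAt) hab
        (fun u hu => hk u (hS₀ u (hIcc ha hb u (Ioo_subset_Icc_self hu))).1)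
      exact (hS₀ x (hIcc ha hb x (Ioo_subset_Icc_self hx))).2 hx0
    · obtain ⟨x, hx, hx0⟩ := exists_hasDerivAt_eq_zero hlt
        (fun u hu => (hk u (hS₀ u (hIcc hb ha u hu)).1).continuousAt.continuousWithinAt) hab.symm
        (fun u hu => hk u (hS₀ u (hIcc hb ha u (Ioo_subset_Icc_self hu))).1)
      exact (hS₀ x (hIcc hb ha x (Ioo_subset_Icc_self hx))).2 hx0
  -- the uniform pole argument along `S₀`
  obtain ⟨s, hs, hk1⟩ := pole_argument_uniform_along hS₀inf hW k k₁ k₂ Zs (fun m => c (σ m)) (fun m => c₁ (σ m))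
    (fun m => e₀ (σ m)) (fun m => e₁ (σ m)) (fun m => e₂ (σ m)) (fun m => e₃ (σ m)) hinj hcW (fun s hs m hm => hPW s (hS₀ s hs).1 m hm)
  exact (hS₀ s hs).2 hk1

end Summit.NavierStokesRegularity.NavierStokesRegularity.Theorems.PoloidalWindowDoorLrcModEntirePoleArgumentUniform

end
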